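import Literature.MathematicalPhysics.QuantumFieldTheory.Balaban1983to89.B7Prop5Flat

/-!
# `Balaban1983to89.B7Eq52RetractionExtension` — T. Bałaban, *Averaging operations for lattice gauge theories*, Commun. Math. Phys. **98** (1985)
17–51 [Balaban1985Averaging], (52) p. 26 with the locality sentences p. 24 ∕ p. 26 («The result is local in the sense that if p = ⟨x, y, z, w⟩, then it
is enough to assume (52) for p ⊂ Bᵏ(x)∪Bᵏ(y)∪Bᵏ(z)∪Bᵏ(w)») ∕ p. 34: **FROM (52) ON A BOX TO (52) EVERYWHERE — THE RETRACTION EXTENSION** `Û` of a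
configuration `U₀` off a box `Q ⊂ ℤᵈ`: `Û` agrees with `U₀` on the bonds of `Q`, takes only the values of `U₀` on `Q` (and `1`), and EVERY plaquette
variable of `Û` is either a plaquette variable of `U₀` inside `Q` or `1` — so `pdev Û ≤ sup_{p ⊂ Q} |U₀(∂p) − 1|`

statement-level skeleton of published theorems with citation tags; proofs where landed; nothing here is a claim about the Yang–Mills mass gap

PDF held: `paper:balaban1985-cmp98-averaging` (journal page = PDF page + 16); p. 24 l.5–7, p. 26 (Prop. 2 and its last sentence), p. 34 l.1–2 read by the
lit-balaban desk for this seat (pub-ymgap bus 2026-08-30 I.32954 ∕ I.32974: «(52) is worded as an unlocalised hypothesis everywhere it is used (Props. 2–5,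
Sect. E), and print separately states locality three times … per-block use print-licensed by the locality sentences»).

THE PRINT.  (52) p. 26: *«we have to assume that |U(∂p) − 1| < α₀η², η = L^{−k} (52) on some set of plaquettes.»*; Prop. 2, last sentence: *«The result
is local in the sense that if p = ⟨x, y, z, w⟩, then it is enough to assume (52) for p ⊂ Bᵏ(x)∪Bᵏ(y)∪Bᵏ(z)∪Bᵏ(w).»*; p. 24: *«this definition is local in
the sense that Ū^k_c, c ⊂ Ω^{(k)}, depends only on the bond variables U_b for b ⊂ B^k(c₋) ∪ B^k(c₊)»*.

WHY THIS FILE (cell `pub-ymgap`, seat dag-n06-l g34, programme P-C2 piece P5; memo `HOME/pub-ymgap-dag-n06-l/C2-INSTANCE-MEMO.md`).  The tree's [B7]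
propositions (`B7Prop2Explicit.prop2_explicit`, …, `B7Eq136SecondOrder.ineq149_secondOrder`) carry (52) AS WORDED: the GLOBAL `pdev U₀ < α₀L^{−2k}` over ALL
plaquettes of `ℤᵈ`.  A consumer holding (52) only on the box `Bʲ(c₋) ∪ Bʲ(c₊)` of one coarse bond `c` — the N06 junction: [B9]'s regularity (3.35)∕(3.36)
gives `|U(∂p) − 1| ≲ O(1)Mα₀L^{−2j}` on the cubes of index `j` only — uses print's locality licence as follows: REPLACE `U₀` off the box by its RETRACTION
EXTENSION `Û` (this file), which satisfies the global (52) with the box's constant, and note that every local object at `c` (`Ū`, `Q_j`, `C_j`, `C_j⁽²⁾`;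
tree: `B7Prop1Local.avgIter_congr`, `B7LocalityGeneral.logCovIter_congr`, `B9Ineq3137LocalSup.CCovIter_congr`) takes the same value at `Û` and at `U₀`.
THE CONSTRUCTION: `r : ℤᵈ → Q` the coordinatewise clamp; `Û(x, μ) := U₀(r x, μ)` if `lo_μ ≤ x_μ < hi_μ` (then `r(x + e_μ) = r x + e_μ`, a bond of `Q`), and
`:= 1` otherwise (then `r(x + e_μ) = r x`).  Whether direction `μ` is degenerate at a corner depends on the `μ`-coordinate only, so the four bonds of a plaquette
in the `(μ, ν)`-plane retract consistently: both directions live ⇒ the plaquette variable is that of the retracted plaquette, which lies in `Q`; one or both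
degenerate ⇒ it is `1`.

WHAT THIS FILE PROVES (0 sorry; definitions with bodies `clampZ`, `retrSite`, `retrCfg`; theorems).
* §1 `clampZ`, `clampZ_of_mem`, `clampZ_succ_of_live`, `clampZ_succ_of_dead_hi ∕ _lo`, `retrSite`, `retrSite_mem`, `retrSite_of_inBox`, `retrSite_add_e_of_live`,
  `retrSite_add_e_of_dead`, `retrSite_add_e_other`.
* §2 `retrCfg`, ★ `retrCfg_eq_of_bondIn` (agreement on the bonds of `Q`), `retrCfg_mem` (values in any subgroup containing those of `U₀`), ★★ `hol_retrCfg_plaqWord`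
  (the plaquette dichotomy), ★★ `norm_hol_retrCfg_plaqWord_sub_one_le` and ★★★ `pdev_retrCfg_le` ∕ `pdev_retrCfg_lt` (`pdev Û ≤ M` whenever
  `|U₀(∂p) − 1| ≤ M` for the plaquettes of `Q`).
NOT CLAIMED: anything about the averages themselves (the locality theorems are cited, not restated); the N06 reading (separate file).
-/

noncomputable section

namespace Literature.MathematicalPhysics.QuantumFieldTheory.Balaban1983to89.B7Eq52RetractionExtension

open B7Prop1Explicit B7Prop1Local B7Prop2Explicit
open B7Prop5Flat (BondIn)

-- `Site` alone would resolve to the torus sites of `Setup.lean`; re-export the `ℤ^d` sites of `B7Prop1Explicit`.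
export B7Prop1Explicit (Site)

variable {d : ℕ}

/-! ## §1 The coordinatewise clamp onto a box -/

section Clamp

/-- the clamp of an integer into `[lo, hi]`. [cite: Balaban1985Averaging, p.26 (Prop. 2, locality sentence), bookkeeping] -/
def clampZ (lo hi t : ℤ) : ℤ := max lo (min hi t)

/-- the clamp fixes `[lo, hi]`. [cite: Balaban1985Averaging, p.26, bookkeeping] -/
theorem clampZ_of_mem {lo hi t : ℤ} (h1 : lo ≤ t) (h2 : t ≤ hi) : clampZ lo hi t = t := by
  unfold clampZ; rw [min_eq_right h2, max_eq_right h1]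

/-- the clamp lands in `[lo, hi]` (for `lo ≤ hi`). [cite: Balaban1985Averaging, p.26, bookkeeping] -/
theorem clampZ_mem {lo hi : ℤ} (h : lo ≤ hi) (t : ℤ) : lo ≤ clampZ lo hi t ∧ clampZ lo hi t ≤ hi := by
  unfold clampZ
  exact ⟨le_max_left _ _, max_le h (min_le_left _ _)⟩

/-- a LIVE step: for `lo ≤ t < hi`, `clamp(t + 1) = clamp t + 1 = t + 1`. [cite: Balaban1985Averaging, p.26, bookkeeping] -/
theorem clampZ_succ_of_live {lo hi t : ℤ} (h1 : lo ≤ t) (h2 : t < hi) : clampZ lo hi (t + 1) = clampZ lo hi t + 1 := by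
  rw [clampZ_of_mem h1 h2.le, clampZ_of_mem (by omega) (by omega)]

/-- a DEAD step (above): for `hi ≤ t`, `clamp(t + 1) = clamp t`. [cite: Balaban1985Averaging, p.26, bookkeeping] -/
theorem clampZ_succ_of_dead_hi {lo hi t : ℤ} (ht : hi ≤ t) : clampZ lo hi (t + 1) = clampZ lo hi t := by
  unfold clampZ
  rw [min_eq_left (by omega : hi ≤ t + 1), min_eq_left ht]

/-- a DEAD step (below): for `t < lo`, `clamp(t + 1) = clamp t`. [cite: Balaban1985Averaging, p.26, bookkeeping] -/
theorem clampZ_succ_of_dead_lo {lo hi t : ℤ} (ht : t < lo) : clampZ lo hi (t + 1) = clampZ lo hi t := by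
  unfold clampZ
  rw [max_eq_left ((min_le_right _ _).trans (by omega)), max_eq_left ((min_le_right _ _).trans ht.le)]

/-- **the retraction** `r : ℤᵈ → Q` onto the box `Q = [lo, hi]` (coordinatewise clamp). [cite: Balaban1985Averaging, p.26 (Prop. 2, locality sentence)] -/
def retrSite (lo hi : Site d) (x : Site d) : Site d := fun i => clampZ (lo i) (hi i) (x i)

/-- `r x ∈ Q`. [cite: Balaban1985Averaging, p.26, bookkeeping] -/
theorem retrSite_mem {lo hi : Site d} (h : ∀ i, lo i ≤ hi i) (x : Site d) : InBox lo hi (retrSite lo hi x) :=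
  fun i => clampZ_mem (h i) (x i)

/-- `r` fixes `Q`. [cite: Balaban1985Averaging, p.26, bookkeeping] -/
theorem retrSite_of_inBox {lo hi x : Site d} (hx : InBox lo hi x) : retrSite lo hi x = x :=
  funext fun i => clampZ_of_mem (hx i).1 (hx i).2

/-- a live direction: `lo_μ ≤ x_μ < hi_μ ⇒ r(x + e_μ) = r x + e_μ`. [cite: Balaban1985Averaging, p.26, bookkeeping] -/
theorem retrSite_add_e_of_live {lo hi x : Site d} {μ : Fin d} (h1 : lo μ ≤ x μ) (h2 : x μ < hi μ) :
    retrSite lo hi (x + e μ) = retrSite lo hi x + e μ := by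
  funext i
  simp only [retrSite, Pi.add_apply, e]
  by_cases hi' : i = μ
  · subst hi'; simp only [Pi.single_eq_same]; exact clampZ_succ_of_live h1 h2
  · simp [Pi.single_eq_of_ne hi']

/-- a dead direction: `¬(lo_μ ≤ x_μ < hi_μ) ⇒ r(x + e_μ) = r x` (for `lo ≤ hi`). [cite: Balaban1985Averaging, p.26, bookkeeping] -/
theorem retrSite_add_e_of_dead {lo hi x : Site d} {μ : Fin d} (hd : ¬ (lo μ ≤ x μ ∧ x μ < hi μ)) :
    retrSite lo hi (x + e μ) = retrSite lo hi x := by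
  funext i
  simp only [retrSite, Pi.add_apply, e]
  by_cases hi' : i = μ
  · subst hi'
    simp only [Pi.single_eq_same]
    rcases not_and_or.1 hd with hlo | hhi
    · exact clampZ_succ_of_dead_lo (not_le.1 hlo)
    · exact clampZ_succ_of_dead_hi (not_lt.1 hhi)
  · simp [Pi.single_eq_of_ne hi']

/-- liveness of direction `μ` is unchanged by a step in another direction `ν ≠ μ`. [cite: Balaban1985Averaging, p.26, bookkeeping] -/
theorem live_add_e_iff {lo hi x : Site d} {μ ν : Fin d} (hne : μ ≠ ν) :
    (lo μ ≤ (x + e ν) μ ∧ (x + e ν) μ < hi μ) ↔ (lo μ ≤ x μ ∧ x μ < hi μ) := by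
  simp [e, Pi.single_eq_of_ne hne]

end Clamp

/-! ## §2 The retraction extension of a configuration and its plaquette variables -/

section Cfg

variable {G : Type*} [Group G]

open Classical in
/-- **THE RETRACTION EXTENSION `Û` of `U₀` off the box `Q = [lo, hi]`**: `Û(x, μ) = U₀(r x, μ)` if direction `μ` is live at `x` (`lo_μ ≤ x_μ < hi_μ`, so that
`(r x, μ)` is a bond of `Q`), and `1` otherwise. [cite: Balaban1985Averaging, p.26 (Prop. 2, locality sentence), p.24 (locality)] -/
def retrCfg (lo hi : Site d) (U₀ : Site d → Fin d → G) : Site d → Fin d → G :=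
  fun x μ => if lo μ ≤ x μ ∧ x μ < hi μ then U₀ (retrSite lo hi x) μ else 1

/-- ★ **`Û = U₀` ON THE BONDS OF `Q`**. [cite: Balaban1985Averaging, p.24 (locality), p.26] -/
theorem retrCfg_eq_of_bondIn {lo hi : Site d} (U₀ : Site d → Fin d → G) {x : Site d} {μ : Fin d} (h : BondIn lo hi x μ) :
    retrCfg lo hi U₀ x μ = U₀ x μ := by
  classical
  have hlive : lo μ ≤ x μ ∧ x μ < hi μ := by
    refine ⟨(h.1 μ).1, ?_⟩
    have := (h.2 μ).2
    simp only [Pi.add_apply, e, Pi.single_eq_same] at this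
    omega
  simp only [retrCfg, hlive, and_self, if_true, retrSite_of_inBox h.1]

/-- `Û` takes values in any subgroup containing the values of `U₀` (e.g. `U(N)`, `SU(N)`). [cite: Balaban1985Averaging, p.20 (G-valued configurations), bookkeeping] -/
theorem retrCfg_mem {S : Subgroup G} {lo hi : Site d} {U₀ : Site d → Fin d → G} (hU₀ : ∀ x μ, U₀ x μ ∈ S) (x : Site d) (μ : Fin d) :
    retrCfg lo hi U₀ x μ ∈ S := by
  classical
  unfold retrCfg; split_ifs
  · exact hU₀ _ _
  · exact S.one_mem

/-- the value of `Û` one step along another direction: `Û(x + e_ν, μ)` for `ν ≠ μ` is `U₀(r(x + e_ν), μ)` or `1` according to the liveness of `μ` at `x`.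
[cite: Balaban1985Averaging, p.26, bookkeeping] -/
theorem retrCfg_add_e_other {lo hi : Site d} (U₀ : Site d → Fin d → G) (x : Site d) {μ ν : Fin d} (hne : μ ≠ ν) :
    retrCfg lo hi U₀ (x + e ν) μ = if lo μ ≤ x μ ∧ x μ < hi μ then U₀ (retrSite lo hi (x + e ν)) μ else 1 := by
  classical
  unfold retrCfg
  by_cases h : lo μ ≤ x μ ∧ x μ < hi μ
  · rw [if_pos ((live_add_e_iff hne).2 h), if_pos h]
  · rw [if_neg (fun h' => h ((live_add_e_iff hne).1 h')), if_neg h]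

/-- ★★ **THE PLAQUETTE DICHOTOMY**: for `μ ≠ ν`, the plaquette variable of `Û` at `x` in the `(μ, ν)`-plane is the plaquette variable of `U₀` at the retracted
corner `r x` if both directions are live at `x` — and then that plaquette lies in `Q` — and `1` otherwise. [cite: Balaban1985Averaging, p.26 (Prop. 2, locality sentence), (44)–(45) p.24] -/
theorem hol_retrCfg_plaqWord {lo hi : Site d} (U₀ : Site d → Fin d → G) (x : Site d) {μ ν : Fin d} (hne : μ ≠ ν) :
    hol (retrCfg lo hi U₀) x (plaqWord μ ν) =
      if (lo μ ≤ x μ ∧ x μ < hi μ) ∧ (lo ν ≤ x ν ∧ x ν < hi ν) then hol U₀ (retrSite lo hi x) (plaqWord μ ν) else 1 := by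
  classical
  -- unfold the two four-letter words
  simp only [plaqWord, hol_cons, hol_nil, mul_one, stepHol_true, stepHol_false, Letter.vec_true, Letter.vec_false]
  have hx1 : x + e μ + e ν + -e μ = x + e ν := by abel
  have hx2 : retrSite lo hi x + e μ + e ν + -e μ = retrSite lo hi x + e ν := by abel
  simp only [add_neg_cancel_right, hx1, hx2, sub_eq_add_neg]
  -- the four bond values of `Û`
  rw [retrCfg_add_e_other U₀ x hne.symm, retrCfg_add_e_other U₀ x hne]
  by_cases hμ : lo μ ≤ x μ ∧ x μ < hi μ <;> by_cases hν : lo ν ≤ x ν ∧ x ν < hi ν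
  · -- both live: the retracted plaquette
    simp only [retrCfg, hμ, hν, and_self, if_true, retrSite_add_e_of_live hμ.1 hμ.2, retrSite_add_e_of_live hν.1 hν.2]
  · simp only [retrCfg, hμ, hν, if_true, if_false, and_true, and_false, mul_one, inv_one, retrSite_add_e_of_dead hν, one_mul,
      mul_inv_cancel]
  · simp only [retrCfg, hμ, hν, if_false, false_and, one_mul, inv_one, mul_one, retrSite_add_e_of_dead hμ,
      mul_inv_cancel]
  · simp only [retrCfg, hμ, hν, if_false, false_and, one_mul, inv_one]

variable {𝔸 : Type*} [NormedRing 𝔸]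

/-- ★★ **EVERY PLAQUETTE VARIABLE OF `Û` IS WITHIN `M` OF `1` WHEN THOSE OF `U₀` INSIDE `Q` ARE** (`M ≥ 0`): print's «it is enough to assume (52) for
p ⊂ …» turned into a configuration satisfying (52) everywhere. [cite: Balaban1985Averaging, (52) p.26, Prop. 2 p.26 (locality sentence)] -/
theorem norm_hol_retrCfg_plaqWord_sub_one_le {lo hi : Site d} (h : ∀ i, lo i ≤ hi i) (U₀ : Site d → Fin d → 𝔸ˣ) {M : ℝ} (hM : 0 ≤ M)
    (hQ : ∀ (y : Site d) (μ ν : Fin d), μ ≠ ν → InBox lo hi y → InBox lo hi (y + e μ) → InBox lo hi (y + e ν) →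
      ‖((hol U₀ y (plaqWord μ ν) : 𝔸ˣ) : 𝔸) - 1‖ ≤ M)
    (x : Site d) (μ ν : Fin d) : ‖((hol (retrCfg lo hi U₀) x (plaqWord μ ν) : 𝔸ˣ) : 𝔸) - 1‖ ≤ M := by
  classical
  by_cases hne : μ = ν
  · subst hne; rw [hol_plaqWord_self]; simpa using hM
  rw [hol_retrCfg_plaqWord U₀ x hne]
  split_ifs with hlive
  · obtain ⟨hμ, hν⟩ := hlive
    have hr : InBox lo hi (retrSite lo hi x) := retrSite_mem h x
    refine hQ _ μ ν hne hr ?_ ?_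
    · rw [← retrSite_add_e_of_live hμ.1 hμ.2]; exact retrSite_mem h _
    · rw [← retrSite_add_e_of_live hν.1 hν.2]; exact retrSite_mem h _
  · simpa using hM

/-- ★★★ **`pdev Û ≤ M`**: the retraction extension satisfies the GLOBAL (52) with the box's constant. [cite: Balaban1985Averaging, (52) p.26, Prop. 2 p.26 (locality sentence)] -/
theorem pdev_retrCfg_le {lo hi : Site d} (h : ∀ i, lo i ≤ hi i) (U₀ : Site d → Fin d → 𝔸ˣ) {M : ℝ} (hM : 0 ≤ M)
    (hQ : ∀ (y : Site d) (μ ν : Fin d), μ ≠ ν → InBox lo hi y → InBox lo hi (y + e μ) → InBox lo hi (y + e ν) →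
      ‖((hol U₀ y (plaqWord μ ν) : 𝔸ˣ) : 𝔸) - 1‖ ≤ M) :
    pdev (retrCfg lo hi U₀) ≤ M := by
  unfold pdev
  exact Real.iSup_le (fun p => norm_hol_retrCfg_plaqWord_sub_one_le h U₀ hM hQ p.1 p.2.1 p.2.2) hM

/-- … strict form: `pdev Û < β` whenever the plaquettes of `Q` are within some `M < β` of `1`. [cite: Balaban1985Averaging, (52) p.26, Prop. 2 p.26 (locality sentence)] -/
theorem pdev_retrCfg_lt {lo hi : Site d} (h : ∀ i, lo i ≤ hi i) (U₀ : Site d → Fin d → 𝔸ˣ) {M β : ℝ} (hM : 0 ≤ M) (hMβ : M < β)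
    (hQ : ∀ (y : Site d) (μ ν : Fin d), μ ≠ ν → InBox lo hi y → InBox lo hi (y + e μ) → InBox lo hi (y + e ν) →
      ‖((hol U₀ y (plaqWord μ ν) : 𝔸ˣ) : 𝔸) - 1‖ ≤ M) :
    pdev (retrCfg lo hi U₀) < β :=
  (pdev_retrCfg_le h U₀ hM hQ).trans_lt hMβ

end Cfg

end Literature.MathematicalPhysics.QuantumFieldTheory.Balaban1983to89.B7Eq52RetractionExtension
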